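import Mathlib.Algebra.BigOperators.Ring.Finset
import Mathlib.Algebra.Order.BigOperators.Group.Finset
import Mathlib.Combinatorics.Enumerative.DoubleCounting
import Mathlib.Data.Finset.Powerset
import Mathlib.Data.Fintype.Pi
import Mathlib.Data.Fintype.Powerset
import Mathlib.Data.Nat.Choose.Sum
import Mathlib.Logic.Function.Iterate
import HarnessLib

/-!
# Cayley's formula for rooted forests

The number of rooted forests on a finite vertex set `S` whose set of roots is a prescribed
`R ⊆ S` is `|R| · |S| ^ (|S| - |R| - 1)` (Cayley 1889; for `|R| = 1` this is Cayley's formula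
`n^{n-2}` for the number of spanning trees of `K_n`, equivalently `n^{n-1}` rooted trees /
`n^{n-2}` trees rooted at a fixed vertex).

**Representation.** A rooted forest is recorded by its *parent map*: a self-map `t` of an ambient
finite type `α` which fixes every root and every point outside `S`, and under which every vertex
of `S` reaches `R` after finitely many steps (`IsForestOn S R t`; the edges are `v → t v` for
`v ∈ S \ R`, oriented towards the roots). `forests S R` is the `Finset` of such maps.

**Results.** `card_forests_eq_sum` — the recursion obtained by deleting one root `ρ` and
recording the set `C` of its children, which become roots of the remaining forest on `S \ {ρ}`
(a bijection, `glue`/`cut`); `card_forests_mul_card` — the closed form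
`#forests S R · |S| = |R| · |S| ^ (|S| - |R|)` for all `R ⊆ S` (this packaging is valid also in
the degenerate cases `R = ∅` and `R = S`); `card_forests_univ_singleton` — `n ^ (n - 2)` forests
of `α` (`|α| = n`) with a single prescribed root, i.e. Cayley's formula. The recursion-and-
induction proof is the one of Aigner–Ziegler (*Proofs from THE BOOK*, chapter "Cayley's formula
for the number of trees", third proof, "essentially due to Riordan and Rényi") for the forest
numbers `T_{n,k} = k n^{n-k-1}` ("which already appears in Cayley's paper"); our `forests S R`
with `|R| = k` prescribed roots are their forests "consisting of `k` trees where the vertices of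
`A` appear in different trees", `|A| = k`, each tree rooted at its vertex of `A`.

Mathlib has no Cayley formula / Prüfer codes (searched `Cayley`, `Prufer`, `Pruefer`,
`n ^ (n - 2)`); only `Finset` sums over powersets and the binomial theorem are reused.

## References

* [AignerZiegler1998] M. Aigner, G. M. Ziegler, *Proofs from THE BOOK*, Springer 1998, Chapter 26
  ("Cayley's formula for the number of trees", held scan pp. 146–150): Theorem (`T_n = n^{n-2}`),
  third proof (recursion (1) `T_{n,k} = Σ_{i=0}^{n-k} binom(n-k,i) T_{n-1,k-1+i}`), Proposition
  (`T_{n,k} = k n^{n-k-1}`, eq. (2)); A. Cayley, *A theorem on trees*, Quart. J. Pure Appl.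
  Math. 23 (1889) 376–378 (ref. [3] there).
-/

namespace Literature.Combinatorics.Enumerative

open Finset Function

variable {α : Type*} [DecidableEq α]

/-! ### Rooted forests as parent maps -/

/-- `t` is (the parent map of) a rooted forest on the vertex set `S` with root set `R`: `t` fixes
every point that is not a non-root vertex of `S` (so roots and outside points are fixed), and
every vertex of `S` reaches `R` under iteration of `t`. [cite: AignerZiegler1998, Ch. 26] -/
def IsForestOn (S R : Finset α) (t : α → α) : Prop :=
  (∀ v, v ∉ S \ R → t v = v) ∧ ∀ v ∈ S, ∃ n : ℕ, t^[n] v ∈ R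

namespace IsForestOn

variable {S R : Finset α} {t : α → α}

/-- Roots are fixed. [folklore] -/
theorem apply_of_mem_roots (h : IsForestOn S R t) {v : α} (hv : v ∈ R) : t v = v :=
  h.1 v (by simp [hv])

/-- Points outside the vertex set are fixed. [folklore] -/
theorem apply_of_not_mem (h : IsForestOn S R t) {v : α} (hv : v ∉ S) : t v = v :=
  h.1 v (by simp [hv])

/-- The parent of a vertex is a vertex (when `R ⊆ S`): otherwise the walk from `v` would be stuck
at the fixed outside point `t v` and never reach `R`. [folklore] -/
theorem apply_mem (h : IsForestOn S R t) (hRS : R ⊆ S) {v : α} (hv : v ∈ S) : t v ∈ S := by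
  by_contra hout
  obtain ⟨n, hn⟩ := h.2 v hv
  cases n with
  | zero =>
    simp only [iterate_zero, id_eq] at hn
    exact hout (by rw [h.apply_of_mem_roots hn]; exact hRS hn)
  | succ n =>
    rw [iterate_succ_apply, Function.iterate_fixed (h.apply_of_not_mem hout)] at hn
    exact hout (hRS hn)

/-- The walk from a vertex stays inside the vertex set. [folklore] -/
theorem iterate_mem (h : IsForestOn S R t) (hRS : R ⊆ S) {v : α} (hv : v ∈ S) (n : ℕ) :
    t^[n] v ∈ S := by
  induction n with
  | zero => simpa using hv
  | succ n ih => rw [iterate_succ_apply']; exact h.apply_mem hRS ih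

end IsForestOn

section Fintype

variable [Fintype α]

open Classical in
/-- The finite set of rooted forests on `S` with root set `R` (as parent maps).
[cite: AignerZiegler1998, Ch. 26] -/
noncomputable def forests (S R : Finset α) : Finset (α → α) :=
  Finset.univ.filter (IsForestOn S R)

/-- Membership in `forests`. [folklore] -/
@[simp] theorem mem_forests {S R : Finset α} {t : α → α} : t ∈ forests S R ↔ IsForestOn S R t := by
  classical
  simp [forests]

/-- With all vertices roots there is exactly one forest, the identity. [folklore] -/
theorem forests_self (S : Finset α) : forests S S = {id} := by
  ext t
  rw [mem_forests, mem_singleton]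
  constructor
  · rintro ⟨h, -⟩; funext v; exact h v (by simp)
  · rintro rfl; exact ⟨fun _ _ => rfl, fun v hv => ⟨0, by simpa using hv⟩⟩

/-- Without roots a nonempty vertex set carries no forest. [folklore] -/
theorem forests_empty {S : Finset α} (hS : S.Nonempty) : forests S ∅ = ∅ := by
  ext t
  simp only [mem_forests, Finset.notMem_empty, iff_false]
  rintro ⟨-, h⟩
  obtain ⟨v, hv⟩ := hS
  obtain ⟨n, hn⟩ := h v hv
  simp at hn

/-! ### Deleting a root: the recursion -/

section Recursion

variable {S R : Finset α} {ρ : α}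

/-- Re-attach: given the children set `C` and a forest `t'` on `S \ {ρ}` with roots
`(R \ {ρ}) ∪ C`, send every `c ∈ C` to `ρ`. [cite: AignerZiegler1998, Ch. 26 (third proof)] -/
def glue (ρ : α) (C : Finset α) (t' : α → α) : α → α :=
  fun v => if v ∈ C then ρ else t' v

/-- Detach: the forest `t` with the children of `ρ` turned into roots. [cite: AignerZiegler1998, Ch. 26 (third proof)] -/
def cut (S R : Finset α) (ρ : α) (t : α → α) : α → α :=
  fun v => if v ∈ (S \ R).filter (fun v => t v = ρ) then v else t v

/-- The children of `ρ` in `t` (non-root vertices sent to `ρ`). [cite: AignerZiegler1998, Ch. 26 (third proof)] -/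
def children (S R : Finset α) (ρ : α) (t : α → α) : Finset α :=
  (S \ R).filter (fun v => t v = ρ)

omit [Fintype α] in
/-- Membership in `children`. [folklore] -/
@[simp] theorem mem_children {t : α → α} {v : α} :
    v ∈ children S R ρ t ↔ (v ∈ S ∧ v ∉ R) ∧ t v = ρ := by
  simp [children]

omit [Fintype α] in
/-- `glue` is a forest on `S` with roots `R`. [cite: AignerZiegler1998, Ch. 26 (third proof)] -/
theorem isForestOn_glue (hρ : ρ ∈ R) {C : Finset α} (hC : C ⊆ S \ R) {t' : α → α}
    (ht' : IsForestOn (S.erase ρ) ((R.erase ρ) ∪ C) t') : IsForestOn S R (glue ρ C t') := by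
  refine ⟨fun v hv => ?_, fun v hv => ?_⟩
  · have hvC : v ∉ C := fun h => hv (hC h)
    simp only [glue, hvC, if_false]
    apply ht'.1
    intro hmem
    rw [mem_sdiff, mem_erase, mem_union, mem_erase] at hmem
    obtain ⟨⟨hne, hvS⟩, hnot⟩ := hmem
    have hvR : v ∈ R := by
      by_contra hvR; exact hv (mem_sdiff.mpr ⟨hvS, hvR⟩)
    exact hnot (Or.inl ⟨hne, hvR⟩)
  · by_cases hvρ : v = ρ
    · exact ⟨0, by simpa [hvρ] using hρ⟩
    obtain ⟨n, hn⟩ := ht'.2 v (by simp [hvρ, hv])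
    -- take the least such `n`; before it the walk avoids `C`, so `glue` follows `t'`
    classical
    let P : ℕ → Prop := fun n => t'^[n] v ∈ R.erase ρ ∪ C
    have hex : ∃ n, P n := ⟨n, hn⟩
    set n₀ := Nat.find hex with hn₀
    have hmin : ∀ i < n₀, t'^[i] v ∉ C := fun i hi h =>
      (Nat.find_min hex hi) (by simp only [P, mem_union]; exact Or.inr h)
    have hagree : ∀ i ≤ n₀, (glue ρ C t')^[i] v = t'^[i] v := by
      intro i hi
      induction i with
      | zero => rfl
      | succ i ih =>
        rw [iterate_succ_apply', iterate_succ_apply', ih (by omega)]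
        simp [glue, hmin i (by omega)]
    have hP : P n₀ := Nat.find_spec hex
    simp only [P, mem_union] at hP
    rcases hP with hR | hCmem
    · exact ⟨n₀, by rw [hagree n₀ le_rfl]; exact mem_of_mem_erase hR⟩
    · refine ⟨n₀ + 1, ?_⟩
      rw [iterate_succ_apply', hagree n₀ le_rfl]
      simpa [glue, hCmem] using hρ

omit [Fintype α] in
/-- The children of `ρ` in `glue ρ C t'` are exactly `C`. [cite: AignerZiegler1998, Ch. 26 (third proof)] -/
theorem children_glue (hρ : ρ ∈ R) (hRS : R ⊆ S) {C : Finset α} (hC : C ⊆ S \ R) {t' : α → α}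
    (ht' : IsForestOn (S.erase ρ) ((R.erase ρ) ∪ C) t') : children S R ρ (glue ρ C t') = C := by
  ext v
  simp only [mem_children, glue]
  constructor
  · rintro ⟨⟨hvS, hvR⟩, hv⟩
    by_contra hvC
    rw [if_neg hvC] at hv
    have hv' : v ∈ S.erase ρ := by
      simp only [mem_erase]; exact ⟨fun h => hvR (h ▸ hρ), hvS⟩
    have hsub : R.erase ρ ∪ C ⊆ S.erase ρ := by
      intro w hw
      simp only [mem_union, mem_erase] at hw
      rcases hw with ⟨hne, hwR⟩ | hwC
      · exact mem_erase.mpr ⟨hne, hRS hwR⟩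
      · have := hC hwC
        simp only [mem_sdiff] at this
        exact mem_erase.mpr ⟨fun h => this.2 (h ▸ hρ), this.1⟩
    have := ht'.apply_mem hsub hv'
    rw [hv] at this
    simp at this
  · intro hvC
    have := hC hvC
    simp only [mem_sdiff] at this
    exact ⟨⟨this.1, this.2⟩, by simp [hvC]⟩

omit [Fintype α] in
/-- `cut ∘ glue = id` on the second component. [cite: AignerZiegler1998, Ch. 26 (third proof)] -/
theorem cut_glue (hρ : ρ ∈ R) (hRS : R ⊆ S) {C : Finset α} (hC : C ⊆ S \ R) {t' : α → α}
    (ht' : IsForestOn (S.erase ρ) ((R.erase ρ) ∪ C) t') : cut S R ρ (glue ρ C t') = t' := by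
  have hch := children_glue hρ hRS hC ht'
  funext v
  unfold cut
  rw [show (S \ R).filter (fun v => glue ρ C t' v = ρ) = children S R ρ (glue ρ C t') from rfl, hch]
  by_cases hvC : v ∈ C
  · rw [if_pos hvC]
    exact (ht'.apply_of_mem_roots (by simp [hvC])).symm
  · rw [if_neg hvC]
    simp [glue, hvC]

omit [Fintype α] in
/-- `glue ∘ cut = id`. [cite: AignerZiegler1998, Ch. 26 (third proof)] -/
theorem glue_cut (t : α → α) : glue ρ (children S R ρ t) (cut S R ρ t) = t := by
  funext v
  by_cases hv : v ∈ children S R ρ t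
  · simp only [glue, hv, if_true]
    exact ((mem_children.mp hv).2).symm
  · simp only [glue, hv, if_false, cut]
    rw [if_neg]
    exact hv

omit [Fintype α] in
/-- The children of a root are non-root vertices. [folklore] -/
theorem children_subset (t : α → α) : children S R ρ t ⊆ S \ R :=
  filter_subset _ _

omit [Fintype α] in
/-- `cut` is a forest on `S \ {ρ}` with roots `(R \ {ρ}) ∪ children`. [cite: AignerZiegler1998, Ch. 26 (third proof)] -/
theorem isForestOn_cut (hρ : ρ ∈ R) (hRS : R ⊆ S) {t : α → α} (ht : IsForestOn S R t) :
    IsForestOn (S.erase ρ) ((R.erase ρ) ∪ children S R ρ t) (cut S R ρ t) := by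
  refine ⟨fun v hv => ?_, fun v hv => ?_⟩
  · unfold cut
    split_ifs with hvC
    · rfl
    · apply ht.1
      intro hmem
      rw [mem_sdiff] at hmem
      obtain ⟨hvS, hvR⟩ := hmem
      have hne : v ≠ ρ := fun h => hvR (h ▸ hρ)
      apply hv
      rw [mem_sdiff, mem_erase, mem_union, mem_erase]
      refine ⟨⟨hne, hvS⟩, ?_⟩
      rintro (⟨-, hvR'⟩ | hch)
      · exact hvR hvR'
      · exact hvC hch
  · have hvS : v ∈ S := mem_of_mem_erase hv
    have hvρ : v ≠ ρ := (mem_erase.mp hv).1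
    classical
    -- first time the `t`-walk from `v` hits `children ∪ R`
    let P : ℕ → Prop := fun n => t^[n] v ∈ children S R ρ t ∪ R
    obtain ⟨n, hn⟩ := ht.2 v hvS
    have hex : ∃ n, P n := ⟨n, by simp only [P, mem_union]; exact Or.inr hn⟩
    set n₀ := Nat.find hex with hn₀
    have hmin : ∀ i < n₀, t^[i] v ∉ children S R ρ t ∪ R := fun i hi => Nat.find_min hex hi
    have hagree : ∀ i ≤ n₀, (cut S R ρ t)^[i] v = t^[i] v := by
      intro i hi
      induction i with
      | zero => rfl
      | succ i ih =>
        rw [iterate_succ_apply', iterate_succ_apply', ih (by omega)]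
        have := hmin i (by omega)
        simp only [mem_union, not_or] at this
        unfold cut
        rw [if_neg]
        exact this.1
    have hP : P n₀ := Nat.find_spec hex
    simp only [P, mem_union] at hP
    rcases hP with hch | hR
    · exact ⟨n₀, by rw [hagree n₀ le_rfl]; exact mem_union_right _ hch⟩
    · by_cases heq : t^[n₀] v = ρ
      · -- then the previous vertex is a child of `ρ`: contradiction with minimality
        exfalso
        cases hn0 : n₀ with
        | zero => rw [hn0] at heq; exact hvρ (by simpa using heq)
        | succ i =>
          have hi : i < n₀ := by omega
          have hnot := hmin i hi
          simp only [mem_union, not_or, mem_children] at hnot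
          apply hnot.1
          refine ⟨⟨ht.iterate_mem hRS hvS i, hnot.2⟩, ?_⟩
          rw [hn0, iterate_succ_apply'] at heq
          exact heq
      · exact ⟨n₀, by
          rw [hagree n₀ le_rfl]
          exact mem_union_left _ (mem_erase.mpr ⟨heq, hR⟩)⟩

/-- **The recursion.** Deleting a root `ρ` and recording its children set `C ⊆ S \ R` is a
bijection between forests on `S` with roots `R` and pairs (`C`, forest on `S \ {ρ}` with roots
`(R \ {ρ}) ∪ C`); hence `#forests S R = Σ_{C ⊆ S \ R} #forests (S \ {ρ}) ((R \ {ρ}) ∪ C)`.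
[cite: AignerZiegler1998, Ch. 26 (third proof, eq. (1): `T_{n,k} = Σ_i binom(n-k,i) T_{n-1,k-1+i}`)] -/
theorem card_forests_eq_sum (hRS : R ⊆ S) (hρ : ρ ∈ R) :
    (forests S R).card =
      ∑ C ∈ (S \ R).powerset, (forests (S.erase ρ) ((R.erase ρ) ∪ C)).card := by
  rw [← Finset.card_sigma]
  symm
  refine Finset.card_nbij' (fun x => glue ρ x.1 x.2) (fun t => ⟨children S R ρ t, cut S R ρ t⟩)
    ?_ ?_ ?_ ?_
  · rintro ⟨C, t'⟩ hx
    simp only [mem_coe, mem_sigma, mem_powerset, mem_forests] at hx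
    simp only [mem_coe, mem_forests]
    exact isForestOn_glue hρ hx.1 hx.2
  · intro t ht
    simp only [mem_coe, mem_forests] at ht
    simp only [mem_coe, mem_sigma, mem_powerset, mem_forests]
    exact ⟨children_subset t, isForestOn_cut hρ hRS ht⟩
  · rintro ⟨C, t'⟩ hx
    simp only [mem_coe, mem_sigma, mem_powerset, mem_forests] at hx
    simp only [Sigma.mk.injEq]
    refine ⟨children_glue hρ hRS hx.1 hx.2, ?_⟩
    rw [cut_glue hρ hRS hx.1 hx.2]
  · intro t _
    exact glue_cut t

end Recursion

/-! ### The closed form -/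

/-- The binomial identity behind the induction:
`Σ_{i=0}^{m} binom(m,i) (q + i) (q + m)^{m-i} = (q + 1) (q + m + 1)^{m-1} (q + m)`, here with
`m = m' + 1`. [cite: AignerZiegler1998, Ch. 26 (third proof)] -/
theorem sum_choose_mul_linear_mul_pow (q m' : ℕ) :
    ∑ i ∈ range (m' + 1 + 1), (m' + 1).choose i * ((q + i) * (q + m' + 1) ^ (m' + 1 - i)) =
      (q + 1) * (q + m' + 2) ^ m' * (q + m' + 1) := by
  set x := q + m' + 1 with hx
  -- split `q + i` into `q` and `i`
  have h1 : ∑ i ∈ range (m' + 1 + 1), (m' + 1).choose i * (q * x ^ (m' + 1 - i)) =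
      q * (x + 1) ^ (m' + 1) := by
    rw [add_comm x 1, add_pow 1 x (m' + 1), mul_sum]
    refine sum_congr rfl fun i _ => ?_
    simp only [Nat.cast_id, one_pow, one_mul]
    ring
  have h2 : ∑ i ∈ range (m' + 1 + 1), (m' + 1).choose i * (i * x ^ (m' + 1 - i)) =
      (m' + 1) * (x + 1) ^ m' := by
    rw [sum_range_succ' _ (m' + 1)]
    simp only [Nat.choose_zero_right, zero_mul, mul_zero, add_zero]
    rw [add_comm x 1, add_pow 1 x m', mul_sum]
    refine sum_congr rfl fun j _ => ?_
    have hc : (m' + 1) * m'.choose j = (m' + 1).choose (j + 1) * (j + 1) :=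
      Nat.add_one_mul_choose_eq m' j
    have he : m' + 1 - (j + 1) = m' - j := by omega
    rw [he]
    simp only [Nat.cast_id, one_pow, one_mul]
    calc (m' + 1).choose (j + 1) * ((j + 1) * x ^ (m' - j))
        = ((m' + 1).choose (j + 1) * (j + 1)) * x ^ (m' - j) := by ring
      _ = ((m' + 1) * m'.choose j) * x ^ (m' - j) := by rw [hc]
      _ = (m' + 1) * (x ^ (m' - j) * m'.choose j) := by ring
  calc ∑ i ∈ range (m' + 1 + 1), (m' + 1).choose i * ((q + i) * x ^ (m' + 1 - i))
      = ∑ i ∈ range (m' + 1 + 1), ((m' + 1).choose i * (q * x ^ (m' + 1 - i)) +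
          (m' + 1).choose i * (i * x ^ (m' + 1 - i))) := by
        refine sum_congr rfl fun i _ => ?_; ring
    _ = q * (x + 1) ^ (m' + 1) + (m' + 1) * (x + 1) ^ m' := by rw [sum_add_distrib, h1, h2]
    _ = (q + 1) * (x + 1) ^ m' * x := by rw [hx]; ring
    _ = (q + 1) * (q + m' + 2) ^ m' * (q + m' + 1) := by rw [hx]

/-- **Cayley's formula for rooted forests** (closed form of the recursion): for `R ⊆ S`,
`#forests S R · |S| = |R| · |S| ^ (|S| - |R|)`, i.e. `#forests S R = |R| · |S| ^ (|S| - |R| - 1)`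
whenever `R ⊊ S` (and `1` for `R = S`, `0` for `R = ∅ ≠ S`).
[cite: AignerZiegler1998, Ch. 26, Proposition (`T_{n,k} = k n^{n-k-1}`, eq. (2))] -/
theorem card_forests_mul_card (S R : Finset α) (hRS : R ⊆ S) :
    (forests S R).card * S.card = R.card * S.card ^ (S.card - R.card) := by
  induction hS : S.card using Nat.strong_induction_on generalizing S R with
  | _ s ih =>
    by_cases hRSeq : R = S
    · subst hRSeq
      simp [forests_self, hS]
    by_cases hR0 : R = ∅
    · subst hR0
      have hSne : S.Nonempty := nonempty_iff_ne_empty.mpr (fun h => hRSeq (h ▸ rfl))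
      simp [forests_empty hSne]
    -- the main case `∅ ≠ R ⊊ S`
    obtain ⟨ρ, hρ⟩ := nonempty_iff_ne_empty.mpr hR0
    have hρS : ρ ∈ S := hRS hρ
    have hcardS : (S.erase ρ).card = s - 1 := by rw [card_erase_of_mem hρS, hS]
    have hs1 : 1 ≤ R.card := card_pos.mpr ⟨ρ, hρ⟩
    have hlt : R.card < s := hS ▸ card_lt_card (ssubset_of_subset_of_ne hRS hRSeq)
    -- write `R.card = q + 1`, `s = q + m' + 2`
    obtain ⟨q, hq⟩ : ∃ q, R.card = q + 1 := ⟨R.card - 1, by omega⟩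
    obtain ⟨m', hm'⟩ : ∃ m', s = q + m' + 2 := ⟨s - q - 2, by omega⟩
    have hSR : (S \ R).card = m' + 1 := by rw [card_sdiff_of_subset hRS, hS]; omega
    -- the recursion, multiplied by `s - 1`
    have hrec := card_forests_eq_sum hRS hρ
    have hterm : ∀ C ∈ (S \ R).powerset,
        (forests (S.erase ρ) (R.erase ρ ∪ C)).card * (s - 1) =
          (q + C.card) * (s - 1) ^ (m' + 1 - C.card) := by
      intro C hC
      rw [mem_powerset] at hC
      have hdisj : Disjoint (R.erase ρ) C := by
        rw [disjoint_iff_ne]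
        rintro a ha b hb rfl
        exact (mem_sdiff.mp (hC hb)).2 (mem_of_mem_erase ha)
      have hsub : R.erase ρ ∪ C ⊆ S.erase ρ := by
        intro w hw
        rcases mem_union.mp hw with hw | hw
        · exact mem_erase.mpr ⟨(mem_erase.mp hw).1, hRS (mem_of_mem_erase hw)⟩
        · have := mem_sdiff.mp (hC hw)
          exact mem_erase.mpr ⟨fun h => this.2 (h ▸ hρ), this.1⟩
      have hcardR : (R.erase ρ ∪ C).card = q + C.card := by
        rw [card_union_of_disjoint hdisj, card_erase_of_mem hρ]; omega
      have h := ih (s - 1) (by omega) (S.erase ρ) (R.erase ρ ∪ C) hsub hcardS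
      rw [hcardR] at h
      rw [h, show s - 1 - (q + C.card) = m' + 1 - C.card by omega]
    have hs1' : s - 1 = q + m' + 1 := by omega
    have hsum : (forests S R).card * (s - 1) =
        ∑ i ∈ range (m' + 1 + 1), (m' + 1).choose i * ((q + i) * (q + m' + 1) ^ (m' + 1 - i)) := by
      rw [hrec, sum_mul, sum_congr rfl hterm, hs1']
      have key := Finset.sum_powerset_apply_card
        (fun i => (q + i) * (q + m' + 1) ^ (m' + 1 - i)) (x := S \ R)
      simp only [nsmul_eq_mul, Nat.cast_id, hSR] at key
      exact key
    rw [sum_choose_mul_linear_mul_pow, hs1'] at hsum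
    -- cancel `s - 1 = q + m' + 1 ≥ 1`
    have hpos : 0 < q + m' + 1 := by omega
    have hcard : (forests S R).card = (q + 1) * (q + m' + 2) ^ m' :=
      Nat.eq_of_mul_eq_mul_right hpos hsum
    rw [hcard, hq, hm']
    have : q + m' + 2 - (q + 1) = m' + 1 := by omega
    rw [this, pow_succ]
    ring

/-- **Cayley's formula.** A finite set of `n ≥ 1` points carries exactly `n ^ (n - 2)` rooted
forests with a single prescribed root `r`, i.e. `n ^ (n - 2)` spanning trees of `K_n` (rooted at
`r`, edges towards `r`). [cite: AignerZiegler1998, Ch. 26, Theorem (Cayley) and Proposition, eq. (2)] -/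
theorem card_forests_univ_singleton (r : α) :
    (forests (Finset.univ : Finset α) {r}).card = Fintype.card α ^ (Fintype.card α - 2) := by
  have h := card_forests_mul_card (Finset.univ : Finset α) {r} (subset_univ _)
  rw [card_singleton, one_mul, card_univ] at h
  have hn : 1 ≤ Fintype.card α := Fintype.card_pos_iff.mpr ⟨r⟩
  -- `#F · n = n ^ (n - 1) = n ^ (n - 2) · n`
  have hpow : Fintype.card α ^ (Fintype.card α - 1) =
      Fintype.card α ^ (Fintype.card α - 2) * Fintype.card α := by
    rcases Nat.lt_or_ge (Fintype.card α) 2 with h2 | h2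
    · have : Fintype.card α = 1 := by omega
      simp [this]
    · rw [← pow_succ]; congr 1; omega
  rw [hpow] at h
  exact Nat.eq_of_mul_eq_mul_right (by omega) h

end Fintype

end Literature.Combinatorics.Enumerative
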